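import Summits.AnomalousDissipation.AnomalousDissipation.Theorems.FloorCertificateEnsembleCeiling.Negative.FormalGuards
import Literature.Analysis.FluidPDE.LerayProjectorTorusProofs
import Literature.Analysis.FluidPDE.EnergySpaceTorusProofs
import Literature.Analysis.FunctionSpaces.TorusLerayHelmholtzProofs

/-!
# `TaylorCertificates.FloorCertificateEnsembleCeiling` (stmt-AnomalousDissipation-14086) — negative side X:
# a ROUGH STATE of `H` (infinite enstrophy), hence `X` WITHOUT the finite-enstrophy guard is FALSE outright

cdisprove seat `refuter-cdisprove-stmt-AnomalousDissipation-14086-g4-0` (generation 4, 2026-08-16).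

`Negative/FormalGuards.lean` (generation 3) proved that the crux `X` with the finite-enstrophy guard
`Torus.eGradNormSq u ≠ ⊤` deleted from its FLOOR would force EVERY element of the energy space `H` to have finite
enstrophy (`floorCertificateEnsembleCeiling_withoutGuard_forces_finite_enstrophy`), and left the conclusion
conditional on "a named rough element of `H`", which the tree did not have (Disproof work file v7, §L(3)).

This file supplies the rough element and closes the conditional:

* `exists_energySpace_of_coeff` — **synthesis into `H`**: an absolutely summable, conjugation-symmetric,
  transversal (`k · c(k) = 0`), mean-free (`c 0 = 0`) coefficient family `c : ℤ³ → ℂ³` is the Fourier-coefficient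
  family of an element of `H` (continuous real field `Re ∑ₖ e_k c_k`; membership in `H` through the Leray projector:
  `P v = v` because `P` acts on coefficients by `lerayCoeff`, the identity on transversal vectors).
* `eGradNormSq_eq_top_of_tsum_eq_top` — if moreover the weighted series `∑_{k ≠ 0} |k|² ‖c k‖²` diverges (in `ℝ≥0∞`),
  that element has `Torus.eGradNormSq = ⊤`.
* `exists_rough_energySpace` — **a rough state**: the lacunary shear `u(x) = ∑ₙ 2·4^{-(n+1)} cos(2π 4^{n+1} x₀) e₁`
  (frequencies `±4^{n+1} e₀`, amplitudes `4^{-(n+1)} e₁`: `∑ ‖c‖ = ∑ 2·4^{-(n+1)} < ∞` but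
  `|k|²‖c(k)‖² = 1` on the support) lies in `H` and has infinite enstrophy; so `H ≠ V`
  (`exists_energySpace_not_mem_energySpaceV`).
* `floorCertificateEnsembleCeiling_false_without_guard` — **`X` without the finite-enstrophy guard is FALSE**
  (for every force and all constants): the composition with
  `floorCertificateEnsembleCeiling_withoutGuard_forces_finite_enstrophy`.

So the guard is load-bearing in the strict sense: deleting it does not weaken or strengthen `X` into another open
statement, it makes it refutable by one explicit state. Def-free; nothing here asserts a Theses statement.
Axioms: `propext`, `Classical.choice`, `Quot.sound`.
-/

noncomputable section

set_option linter.dupNamespace false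

open MeasureTheory UnitAddTorus Filter Topology
open scoped InnerProductSpace ENNReal

namespace Summit.AnomalousDissipation.AnomalousDissipation.Theorems.FloorCertificateEnsembleCeiling.Negative

open Literature.Analysis.FunctionSpaces Literature.Analysis.FluidPDE
open Summit.AnomalousDissipation.AnomalousDissipation.Theses.TaylorCertificates

/-! ## §1 Synthesis of an element of `H` from a transversal coefficient family -/

/-- **Synthesis into `H`.** An absolutely summable, conjugation-symmetric coefficient family `c : ℤ³ → ℂ³` with
`c 0 = 0` and `k · c(k) = 0` for every `k` is the Fourier-coefficient family of some `r ∈ H`: the continuous real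
field `x ↦ Re ∑ₖ e_k(x) c_k` (`Torus.continuous_tsum_mFourier_smul`, reality by the symmetry) has these
coefficients (`Torus.mFourierCoeff_tsum_mFourier_smul`), and its `L²` class is fixed by the Leray projector
(`Torus.mFourierCoeff_lerayProjector_apply`, `Torus.leraySym_of_transversal`), hence lies in `H`. -/
theorem exists_energySpace_of_coeff {c : (Fin 3 → ℤ) → EuclideanSpace ℂ (Fin 3)}
    (hc : Summable fun k => ‖c k‖) (hsym : Torus.IsConjSymm c) (h0 : c 0 = 0)
    (htr : ∀ k : Fin 3 → ℤ, ∑ i, ((k i : ℤ) : ℂ) * c k i = 0) :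
    ∃ r : Torus.energySpace (Fin 3), ∀ k, mFourierCoeff (EuclideanSpace.complexify ∘ (((r : Lp (EuclideanSpace ℝ (Fin 3)) 2 (volume : Measure (UnitAddTorus (Fin 3))))) : UnitAddTorus (Fin 3) → EuclideanSpace ℝ (Fin 3))) k = c k := by
  classical
  -- the complex series and its reality
  set uC : UnitAddTorus (Fin 3) → EuclideanSpace ℂ (Fin 3) := fun x => ∑' k, mFourier k x • c k with huC
  have hcontC : Continuous uC := Torus.continuous_tsum_mFourier_smul hc
  have hreal : ∀ x, EuclideanSpace.conjVec (uC x) = uC x := by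
    intro x
    have hsum : Summable fun k => mFourier k x • c k := (Torus.hasSum_mFourier_smul hc x).summable
    have h1 : EuclideanSpace.conjVec (∑' k, mFourier k x • c k) = ∑' k, EuclideanSpace.conjVec (mFourier k x • c k) :=
      (EuclideanSpace.conjVecL.map_tsum hsum : _)
    change EuclideanSpace.conjVec (∑' k, mFourier k x • c k) = ∑' k, mFourier k x • c k
    rw [h1, ← (Equiv.neg (Fin 3 → ℤ)).tsum_eq (fun k => mFourier k x • c k)]
    refine tsum_congr fun k => ?_
    rw [Equiv.neg_apply, EuclideanSpace.conjVec_smul, hsym k]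
    congr 1
    rw [← mFourier_neg]
  -- the real field
  set u : UnitAddTorus (Fin 3) → EuclideanSpace ℝ (Fin 3) := fun x => EuclideanSpace.realPart (uC x) with hu
  have hcu : (EuclideanSpace.complexify ∘ u) = uC := funext fun x => EuclideanSpace.complexify_realPart (hreal x)
  have hcont : Continuous u := EuclideanSpace.realPart.continuous.comp hcontC
  obtain ⟨K, hK⟩ := Torus.exists_forall_norm_le_of_continuous_torus hcont
  have hmem : MemLp u 2 (volume : Measure (UnitAddTorus (Fin 3))) :=
    MemLp.of_bound hcont.aestronglyMeasurable K (Eventually.of_forall hK)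
  have hcoef_u : ∀ k, mFourierCoeff (EuclideanSpace.complexify ∘ u) k = c k := fun k => by
    rw [hcu]
    exact Torus.mFourierCoeff_tsum_mFourier_smul hc k
  -- its `L²` class
  set U : Lp (EuclideanSpace ℝ (Fin 3)) 2 (volume : Measure (UnitAddTorus (Fin 3))) := hmem.toLp u with hUdef
  have hUae : ((U : UnitAddTorus (Fin 3) → EuclideanSpace ℝ (Fin 3))) =ᵐ[volume] u := hmem.coeFn_toLp
  have hcoef_U : ∀ k, mFourierCoeff (EuclideanSpace.complexify ∘ ((U : UnitAddTorus (Fin 3) → EuclideanSpace ℝ (Fin 3)))) k = c k := fun k => by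
    rw [← hcoef_u k]
    refine Torus.mFourierCoeff_congr_ae ?_ k
    filter_upwards [hUae] with x hx
    simp [hx]
  -- the Leray projector fixes `U`, so `U ∈ H`
  have hP : Torus.lerayProjector (Fin 3) U = U := by
    refine Torus.eq_of_forall_mFourierCoeff_complexify_coe_eq fun k => ?_
    rw [Torus.mFourierCoeff_lerayProjector_apply, hcoef_U k]
    by_cases hk : k = 0
    · subst hk
      rw [Torus.lerayCoeff_zero, h0]
    · rw [Torus.lerayCoeff_of_ne_zero hk]
      exact Torus.leraySym_of_transversal (htr k)
  have hUmem : U ∈ Torus.energySpace (Fin 3) := hP ▸ Torus.lerayProjector_apply_mem U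
  exact ⟨⟨U, hUmem⟩, hcoef_U⟩

/-! ## §2 Infinite enstrophy read off the coefficients -/

/-- If the enstrophy series `∑_{k ≠ 0} |k|² ‖v̂(k)‖²` of a field diverges in `ℝ≥0∞`, then `Torus.eGradNormSq v = ⊤`
(unfolding of the spectral definition: `eGradNormSq v = 4π² · (∑ …)`). -/
theorem eGradNormSq_eq_top_of_tsum_eq_top {v : UnitAddTorus (Fin 3) → EuclideanSpace ℝ (Fin 3)}
    (h : (∑' k : Fin 3 → ℤ, (if k = 0 then 0 else ENNReal.ofReal (Torus.freqNormSq k ^ (1 : ℝ))) *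
      ‖mFourierCoeff (EuclideanSpace.complexify ∘ v) k‖ₑ ^ 2) = ⊤) :
    Torus.eGradNormSq v = ⊤ := by
  have h4 : ENNReal.ofReal (4 * Real.pi ^ 2) ≠ 0 := by
    have : (0 : ℝ) < 4 * Real.pi ^ 2 := by positivity
    exact (ENNReal.ofReal_pos.2 this).ne'
  unfold Torus.eGradNormSq Torus.eHomSobolevSeminorm
  rw [h, ENNReal.top_rpow_of_pos (by norm_num : (0 : ℝ) < 1 / 2), ENNReal.top_pow two_ne_zero, ENNReal.mul_top h4]

/-! ## §3 The rough state: a lacunary shear -/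

/-- **A rough element of `H`** (`H ≠ V` on `T³`, with an explicit witness): there is `r ∈ H` with
`Torus.eGradNormSq r = ⊤`. Witness: Fourier support `{± 4^{n+1} e₀ : n ∈ ℕ}`, coefficients `4^{-(n+1)} e₁` there —
absolutely summable (`∑ₙ 2·4^{-(n+1)} = 2/3`), conjugation symmetric and real, transversal (`e₁ ⊥ e₀`), mean-free;
on the support `|k|² ‖c(k)‖² = 16^{n+1} · 16^{-(n+1)} = 1`, so the enstrophy series dominates `∑ₙ 1 = ∞`. The field is
the continuous lacunary shear `u(x) = (0, ∑ₙ 2·4^{-(n+1)} cos(2π 4^{n+1} x₀), 0)`. -/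
theorem exists_rough_energySpace :
    ∃ r : Torus.energySpace (Fin 3), Torus.eGradNormSq (((r : Lp (EuclideanSpace ℝ (Fin 3)) 2 (volume : Measure (UnitAddTorus (Fin 3))))) : UnitAddTorus (Fin 3) → EuclideanSpace ℝ (Fin 3)) = ⊤ := by
  classical
  -- frequencies and (real) amplitudes, indexed by `ℕ ⊕ ℕ` (sign, exponent)
  let ex : ℕ ⊕ ℕ → ℕ := Sum.elim (fun n => n) (fun n => n)
  let fr : ℕ ⊕ ℕ → ℤ := Sum.elim (fun n => (4 : ℤ) ^ (n + 1)) (fun n => -(4 : ℤ) ^ (n + 1))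
  let idx : ℕ ⊕ ℕ → (Fin 3 → ℤ) := fun p => Pi.single 0 (fr p)
  let ampR : ℕ ⊕ ℕ → EuclideanSpace ℝ (Fin 3) := fun p => (((4 : ℝ) ^ (ex p + 1))⁻¹) • EuclideanSpace.single 1 (1 : ℝ)
  let amp : ℕ ⊕ ℕ → EuclideanSpace ℂ (Fin 3) := fun p => EuclideanSpace.complexify (ampR p)
  let c : (Fin 3 → ℤ) → EuclideanSpace ℂ (Fin 3) := Function.extend idx amp 0
  -- elementary facts about the index map
  have hfr_pos : ∀ n : ℕ, (0 : ℤ) < (4 : ℤ) ^ (n + 1) := fun n => by positivity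
  have hfr_inj : Function.Injective fr := by
    rintro (n | n) (m | m) h
    · simp only [fr, Sum.elim_inl] at h
      have h' : (4 : ℕ) ^ (n + 1) = 4 ^ (m + 1) := by exact_mod_cast h
      have h2 : n + 1 = m + 1 := Nat.pow_right_injective (by norm_num : 2 ≤ 4) h'
      rw [show n = m by omega]
    · simp only [fr, Sum.elim_inl, Sum.elim_inr] at h
      linarith [hfr_pos n, hfr_pos m]
    · simp only [fr, Sum.elim_inl, Sum.elim_inr] at h
      linarith [hfr_pos n, hfr_pos m]
    · simp only [fr, Sum.elim_inr, neg_inj] at h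
      have h' : (4 : ℕ) ^ (n + 1) = 4 ^ (m + 1) := by exact_mod_cast h
      have h2 : n + 1 = m + 1 := Nat.pow_right_injective (by norm_num : 2 ≤ 4) h'
      rw [show n = m by omega]
  have hidx_inj : Function.Injective idx := fun p q h =>
    hfr_inj (Pi.single_injective (M := fun _ : Fin 3 => ℤ) (0 : Fin 3) h)
  have hfr_ne : ∀ p, fr p ≠ 0 := by
    rintro (n | n) <;> simp only [fr, Sum.elim_inl, Sum.elim_inr, ne_eq, neg_eq_zero] <;> exact (hfr_pos n).ne'
  have hidx_ne : ∀ p, idx p ≠ 0 := fun p h => hfr_ne p (by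
    have := congrFun h 0
    simpa [idx] using this)
  -- the `swap` of signs realises `k ↦ -k` on the support
  let sw : ℕ ⊕ ℕ → ℕ ⊕ ℕ := Sum.elim (fun n => Sum.inr n) (fun n => Sum.inl n)
  have hsw_idx : ∀ p, idx (sw p) = -idx p := by
    rintro (n | n)
    · simp only [idx, fr, sw, Sum.elim_inl, Sum.elim_inr, ← Pi.single_neg]
    · simp only [idx, fr, sw, Sum.elim_inl, Sum.elim_inr, ← Pi.single_neg, neg_neg]
  have hsw_amp : ∀ p, amp (sw p) = amp p := by
    rintro (n | n) <;> simp only [amp, ampR, ex, sw, Sum.elim_inl, Sum.elim_inr]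
  -- values of `c`
  have hc_on : ∀ p, c (idx p) = amp p := fun p => hidx_inj.extend_apply amp 0 p
  have hc_off : ∀ k, (¬ ∃ p, idx p = k) → c k = 0 := fun k hk =>
    (Function.extend_apply' (f := idx) amp (0 : (Fin 3 → ℤ) → EuclideanSpace ℂ (Fin 3)) k hk).trans rfl
  have hc0 : c 0 = 0 := hc_off 0 (fun ⟨p, hp⟩ => hidx_ne p hp)
  -- norms of the amplitudes
  have hnorm_amp : ∀ p, ‖amp p‖ = ((4 : ℝ) ^ (ex p + 1))⁻¹ := fun p => by
    simp only [amp, ampR, EuclideanSpace.norm_complexify, norm_smul, norm_inv, norm_pow, Real.norm_ofNat,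
      EuclideanSpace.single, PiLp.norm_single, norm_one, mul_one]
  -- (1) absolute summability
  have hsumm : Summable fun k => ‖c k‖ := by
    have hzero : ∀ k ∉ Set.range idx, ‖c k‖ = 0 := fun k hk => by
      rw [hc_off k (by rintro ⟨p, hp⟩; exact hk ⟨p, hp⟩), norm_zero]
    refine (hidx_inj.summable_iff hzero).1 ?_
    have hgeo : HasSum (fun n : ℕ => ((4 : ℝ) ^ (n + 1))⁻¹) ((1 / 4 : ℝ) * (1 - 1 / 4)⁻¹) := by
      have h := (hasSum_geometric_of_lt_one (by norm_num : (0 : ℝ) ≤ 1 / 4) (by norm_num : (1 / 4 : ℝ) < 1)).mul_left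
        (1 / 4 : ℝ)
      refine h.congr_fun fun n => ?_
      rw [pow_succ, mul_inv, one_div, inv_pow, mul_comm]
    have hl : HasSum (((fun k => ‖c k‖) ∘ idx) ∘ Sum.inl) ((1 / 4 : ℝ) * (1 - 1 / 4)⁻¹) := by
      refine hgeo.congr_fun fun n => ?_
      simp only [Function.comp_apply, hc_on, hnorm_amp, ex, Sum.elim_inl]
    have hr : HasSum (((fun k => ‖c k‖) ∘ idx) ∘ Sum.inr) ((1 / 4 : ℝ) * (1 - 1 / 4)⁻¹) := by
      refine hgeo.congr_fun fun n => ?_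
      simp only [Function.comp_apply, hc_on, hnorm_amp, ex, Sum.elim_inr]
    exact (HasSum.sum (f := (fun k => ‖c k‖) ∘ idx) hl hr).summable
  -- (2) conjugation symmetry (the amplitudes are real and the support is symmetric)
  have hsym : Torus.IsConjSymm c := by
    intro k
    by_cases hk : ∃ p, idx p = k
    · obtain ⟨p, rfl⟩ := hk
      rw [← hsw_idx p, hc_on, hc_on, hsw_amp]
      simp only [amp, EuclideanSpace.conjVec_complexify]
    · have hk' : ¬ ∃ p, idx p = -k := by
        rintro ⟨p, hp⟩
        exact hk ⟨sw p, by rw [hsw_idx, hp, neg_neg]⟩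
      rw [hc_off k hk, hc_off (-k) hk', EuclideanSpace.conjVec_zero]
  -- (3) transversality `k · c(k) = 0`
  have htr : ∀ k : Fin 3 → ℤ, ∑ i, ((k i : ℤ) : ℂ) * c k i = 0 := by
    intro k
    by_cases hk : ∃ p, idx p = k
    · obtain ⟨p, rfl⟩ := hk
      rw [hc_on]
      simp only [idx, amp, ampR, Fin.sum_univ_three, Pi.single_apply, EuclideanSpace.complexify_apply,
        PiLp.smul_apply, EuclideanSpace.single, PiLp.single_apply, smul_eq_mul]
      simp
    · rw [hc_off k hk]
      simp
  -- the element of `H`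
  obtain ⟨r, hr⟩ := exists_energySpace_of_coeff hsumm hsym hc0 htr
  refine ⟨r, eGradNormSq_eq_top_of_tsum_eq_top ?_⟩
  -- (4) the enstrophy series diverges: it dominates `∑ₙ 1` along `n ↦ idx (inl n)`
  simp_rw [hr]
  set term : (Fin 3 → ℤ) → ℝ≥0∞ := fun k =>
    (if k = 0 then 0 else ENNReal.ofReal (Torus.freqNormSq k ^ (1 : ℝ))) * ‖c k‖ₑ ^ 2 with hterm
  have hinj : Function.Injective (idx ∘ Sum.inl) := hidx_inj.comp Sum.inl_injective
  have hone : ∀ n : ℕ, term ((idx ∘ Sum.inl) n) = 1 := by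
    intro n
    have hk : idx (Sum.inl n) ≠ 0 := hidx_ne _
    simp only [hterm, Function.comp_apply, if_neg hk, Real.rpow_one]
    rw [hc_on, ← ofReal_norm, hnorm_amp, ← ENNReal.ofReal_pow (by positivity), ← ENNReal.ofReal_mul
      (by unfold Torus.freqNormSq; positivity), ← ENNReal.ofReal_one]
    congr 1
    have hfreq : Torus.freqNormSq (idx (Sum.inl n)) = ((4 : ℝ) ^ (n + 1)) ^ 2 := by
      simp only [Torus.freqNormSq, idx, fr, Sum.elim_inl, Fin.sum_univ_three, Pi.single_apply]
      push_cast
      simp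
    rw [hfreq]
    simp only [ex, Sum.elim_inl]
    field_simp
  have hle : (∑' n : ℕ, term ((idx ∘ Sum.inl) n)) ≤ ∑' k, term k := ENNReal.tsum_comp_le_tsum_of_injective hinj term
  rw [tsum_congr hone, ENNReal.tsum_const_eq_top_of_ne_zero one_ne_zero] at hle
  exact le_antisymm le_top hle

/-- **`H ≠ V` on `T³`** (with a witness): some finite-energy solenoidal mean-zero field has infinite enstrophy. -/
theorem exists_energySpace_not_mem_energySpaceV : ∃ r : Torus.energySpace (Fin 3), (r : Lp (EuclideanSpace ℝ (Fin 3)) 2 (volume : Measure (UnitAddTorus (Fin 3)))) ∉ Torus.energySpaceV (Fin 3) := by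
  obtain ⟨r, hr⟩ := exists_rough_energySpace
  exact ⟨r, fun hV => (hV.2.eGradNormSq_lt_top).ne hr⟩

/-! ## §4 `X` without the finite-enstrophy guard is false -/

/-- **The finite-enstrophy guard of `X` is load-bearing, unconditionally**: the crux
`TaylorCertificates.FloorCertificateEnsembleCeiling` with the guard `Torus.eGradNormSq u ≠ ⊤` DELETED from its floor
clause (verbatim otherwise) is FALSE — by `floorCertificateEnsembleCeiling_withoutGuard_forces_finite_enstrophy`
(generation 3: the unguarded floor forces `H = V`) and the rough state of `exists_rough_energySpace`. Any proof of `X`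
therefore uses the guard, exactly to discard the states where `ν·(⊤).toReal = 0` makes the inequality junk. -/
theorem floorCertificateEnsembleCeiling_false_without_guard :
    ¬ ∃ f : UnitAddTorus (Fin 3) → EuclideanSpace ℝ (Fin 3), Torus.IsSmooth f ∧ Torus.IsDivFree f ∧ Torus.HasZeroMean f ∧
      ∃ (ε₀ E ν₀ : ℝ), 0 < ε₀ ∧ 0 < ν₀ ∧ ∀ ν : ℝ, 0 < ν → ν < ν₀ →
        (∃ (Φ₁ : Torus.CylindricalTest (Fin 3)) (θ₁ : ℝ), θ₁ ≤ 0 ∧ ∀ u : Torus.energySpace (Fin 3),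
          ‖u‖ ^ 2 ≤ 16 * (∫ x, ‖f x‖ ^ 2) / ν ^ 2 →
          ε₀ ≤ ν * (Torus.eGradNormSq ((u : Lp (EuclideanSpace ℝ (Fin 3)) 2 (volume : Measure (UnitAddTorus (Fin 3)))) : UnitAddTorus (Fin 3) → EuclideanSpace ℝ (Fin 3))).toReal +
            Torus.nsGeneratorPairing ν f u (Φ₁.grad u) +
            2 * θ₁ * (Torus.pairing (u : Lp (EuclideanSpace ℝ (Fin 3)) 2 (volume : Measure (UnitAddTorus (Fin 3)))) f -
              ν * (Torus.eGradNormSq ((u : Lp (EuclideanSpace ℝ (Fin 3)) 2 (volume : Measure (UnitAddTorus (Fin 3)))) : UnitAddTorus (Fin 3) → EuclideanSpace ℝ (Fin 3))).toReal)) ∧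
        (∀ μ : Measure (Torus.energySpace (Fin 3)), Torus.IsStationaryStatisticalSolution ν f μ →
          Integrable (fun v : Torus.energySpace (Fin 3) => ‖v‖ ^ 2) μ → Torus.ensembleEnergy μ ≤ E) := by
  intro hX
  obtain ⟨r, hr⟩ := exists_rough_energySpace
  exact floorCertificateEnsembleCeiling_withoutGuard_forces_finite_enstrophy hX r hr

end Summit.AnomalousDissipation.AnomalousDissipation.Theorems.FloorCertificateEnsembleCeiling.Negative

end
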